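import Summits.QuantumFields.YangMills.Theorems.BalabanUVNodesN15AtSpineCarriersBackground
import Summits.QuantumFields.YangMills.Theorems.BalabanUVNodesN15VectorPieceVWordsCoarse

/-!
# YM-DAG node N15 (= NE2) AT THE RATE CARRIERS OF RECORD — THE (3.60) WORDS FAMILIES WITH THE PAIRING-CONSISTENT COARSE `V′₁` (coarse coefficients at the
# derived triple of the block mean `Ā`): the K4 stub `YMDAG.UVSplit.S_N15 RRec` closed over every rate-carrier predicate whose NE2 component carries
# `vWGCVecFamily4` with the LINEARISED or the PARALLEL-TRANSPORT species — operator layer HYPOTHESIS-FREE by name, site-kernel and unit-lattice layers displayed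

Track A of `YM-PLAN.md` (cell `pub-ymgap`, HUMAN RULING D-0062), node **N15**; typed by seat `pub-ymgap-dag-n15-c` (generation g4) as the spine-carrier faces of its
(V8)-re-keyed (3.60) words chain (`…N15VectorPieceVWordsCoarse`).  Shape twin: this seat's `…AtSpineCarriersVWordsSpecies` (same namespace, nothing restated; that
file keeps the faces of the g3-coarse-side families `vWGVecFamily4`).  Producers consumed BY NAME: `VectorPiece.ne2PlusOperator_vectorPiece_vWordsLinC`,
`VectorPiece.ne2PlusOperator_vectorPiece_vWordsExpC`.  Kernel bookkeeping: 0 `def`, 0 `sorry`, standard axioms.  COUNT-NEUTRAL; `--supports` the K3⁗ item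
`SpineGivenEndpointR13Sep` (stmt-QuantumFields-20292, `--as helper`; plan KEY-18 ∕ dag-lead WORDS-140).

THE STUB.  `S_N15 RRec := ∀ F D g₀ os R, RRec F D g₀ os R → N15At R.ne2`, `N15At c := NE2PlusOperator c.c35 c.pi c.Kop ∧ NE2PlusSite 4 c.p c.c35 c.pi c.Ksite ∧
NE2PlusUnit c.c35 c.pi c.Kunit c.inΛ c.unitDist`.

WHAT THIS MODULE IS.  §1 faces `n15At_vectorPiece_vWordsLinC_of_layers`, `n15At_vectorPiece_vWordsExpC_of_layers` (for `d + 1 ≥ 2`, `L ≥ 1`, `c₃₅ > 0`, coordinates `e`, a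
(3.24) weight `a`: `N15At` from the site-kernel and unit-lattice layers ALONE).  §2 closers `s_N15_of_vWordsLinCReading`, `s_N15_of_vWordsExpCReading`.  §3 guards
`not_n15At_iff_site_or_unit_fails_vWordsLinC`, `…_vWordsExpC`.  §4 the same three faces for F13's `V′₁`-only family `v1GCVecFamily4`
(`n15At_vectorPiece_v1GC_of_layers`, `s_N15_of_v1GCReading`, `not_n15At_iff_site_or_unit_fails_v1GC`).

HONEST FRAMING.  NE2 is NOT PRINTED beyond King's scalar template and NOT PROVED for Bałaban's `G(U)`.  What enters hypothesis-free is the operator layer of the LINEAR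
(U = 1) vector single-scale piece of [B5]∕[B6]∕King (4.42) tensored with `1_𝔤`, dressed by the print's `V′₁(A)` of (3.52) MINUS the three averaging words of (3.60) with
the block mean CONCRETE and the averaging-perturbation species CONSTRUCTED at `U ≡ 1` on the ONE-LEVEL staircase contour: first order (`…Lin`) or the parallel transport
itself (`…Exp`: `Π_Γ exp(η ad A′) − 1`, NOT the print's multi-level product with `U(b)` factors and rotations `R(·)`); (3.35) = OUR unit-scale reading of the printed C²
pair; transport of configurations = fibrewise mean (linearised (C3)) with the coarse `V′₁` AT THE DERIVED TRIPLE OF THE TRANSPORTED FIELD (pairing-consistent); NOT the multiscale carrier of NODE 00; the SITE-KERNEL and UNIT-LATTICE layers of `N15At` remain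
DISPLAYED.  N15 is NOT discharged (0∕1 at every record); typed 28∕28, discharged count untouched; one finite four-torus programme at fixed `ε` — NOT ℝ⁴, NOT infinite
volume, NOT OS, NOT a mass gap, NOT Clay.  Restate-immune.  No decl below carries a cite tag.
-/

noncomputable section

open Finset

namespace Summit.QuantumFields.YangMills.Theorems.N15AtSpineCarriers

open Literature.MathematicalPhysics.QuantumFieldTheory.Balaban1983to89
open Literature.MathematicalPhysics.QuantumFieldTheory.Balaban1983to89.T4Continuum
open Literature.MathematicalPhysics.QuantumFieldTheory.Balaban1983to89.B9 (SiteKernel)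
open Literature.MathematicalPhysics.QuantumFieldTheory.Balaban1983to89.T4EtaRate (PairedInstance NE2PlusOperator NE2PlusSite NE2PlusUnit)
open Summit.QuantumFields.YangMills.BalabanUVNodes.N15.VectorPiece (VecIndexS v1GVecInstance vWGCVecFamily4 linFc linFsc linFf linFsf expFc expFsc expFf expFsf
  ne2PlusOperator_vectorPiece_vWordsLinC ne2PlusOperator_vectorPiece_vWordsExpC v1GCVecFamily4 ne2PlusOperator_vectorPiece_v1GC)
open YMDAG.UVSplit (Datum NE2Carriers RateCarriers RateRecordPred N15At RatesAt S_N15)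

variable {N : ℕ} [NeZero N] {d : ℕ} {L : ℕ} [NeZero L] {ι : Type} [Fintype ι] [DecidableEq ι]
  {𝔄 : Type} [NormedRing 𝔄] [NormedAlgebra ℝ 𝔄] [CompleteSpace 𝔄] (e : 𝔄 ≃L[ℝ] (ι → ℝ)) (a : ℝ)

/-! ## §1 The node faces with a constructed species: `N15At` from the site and unit layers alone -/

section Faces

/-- **`N15At` WITH THE FULL PERTURBATION AND THE LINEARISED SPECIES LIVE, FROM THE SITE AND UNIT LAYERS ALONE** (operator conjunct =
`VectorPiece.ne2PlusOperator_vectorPiece_vWordsLinC`, hypothesis-free for `d + 1 ≥ 2`, `L ≥ 1`, `c₃₅ > 0`). [bookkeeping] -/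
theorem n15At_vectorPiece_vWordsLinC_of_layers (hd : 1 ≤ d) (hL : 1 ≤ L) {c35 : ℝ} (hc35 : 0 < c35) (p : ℝ)
    (Ksite Kunit : ∀ j : VecIndexS d L, SiteKernel (v1GVecInstance (d := d) 𝔄 ι L hL j).gc (v1GVecInstance (d := d) 𝔄 ι L hL j).Bf)
    (inΛ : ∀ j : VecIndexS d L, (v1GVecInstance (d := d) 𝔄 ι L hL j).gc.Site → Prop)
    (unitDist : ∀ j : VecIndexS d L, (v1GVecInstance (d := d) 𝔄 ι L hL j).gc.Site → (v1GVecInstance (d := d) 𝔄 ι L hL j).gc.Site → ℝ)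
    (hsite : NE2PlusSite 4 p c35 (v1GVecInstance (d := d) 𝔄 ι L hL) Ksite)
    (hunit : NE2PlusUnit c35 (v1GVecInstance (d := d) 𝔄 ι L hL) Kunit inΛ unitDist) :
    N15At { I := VecIndexS d L, c35 := c35, p := p, pi := v1GVecInstance (d := d) 𝔄 ι L hL,
            Kop := vWGCVecFamily4 (d := d) 𝔄 ι e L a hL (linFc ι e L) (linFsc ι e L) (linFf ι e L) (linFsf ι e L),
            Ksite := Ksite, Kunit := Kunit, inΛ := inΛ, unitDist := unitDist } :=
  ⟨ne2PlusOperator_vectorPiece_vWordsLinC (d := d) e a hd hL c35 hc35, hsite, hunit⟩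

/-- **`N15At` WITH THE FULL PERTURBATION AND THE PARALLEL-TRANSPORT SPECIES LIVE, FROM THE SITE AND UNIT LAYERS ALONE** (operator conjunct =
`VectorPiece.ne2PlusOperator_vectorPiece_vWordsExpC`, hypothesis-free for `d + 1 ≥ 2`, `L ≥ 1`, `c₃₅ > 0`). [bookkeeping] -/
theorem n15At_vectorPiece_vWordsExpC_of_layers (hd : 1 ≤ d) (hL : 1 ≤ L) {c35 : ℝ} (hc35 : 0 < c35) (p : ℝ)
    (Ksite Kunit : ∀ j : VecIndexS d L, SiteKernel (v1GVecInstance (d := d) 𝔄 ι L hL j).gc (v1GVecInstance (d := d) 𝔄 ι L hL j).Bf)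
    (inΛ : ∀ j : VecIndexS d L, (v1GVecInstance (d := d) 𝔄 ι L hL j).gc.Site → Prop)
    (unitDist : ∀ j : VecIndexS d L, (v1GVecInstance (d := d) 𝔄 ι L hL j).gc.Site → (v1GVecInstance (d := d) 𝔄 ι L hL j).gc.Site → ℝ)
    (hsite : NE2PlusSite 4 p c35 (v1GVecInstance (d := d) 𝔄 ι L hL) Ksite)
    (hunit : NE2PlusUnit c35 (v1GVecInstance (d := d) 𝔄 ι L hL) Kunit inΛ unitDist) :
    N15At { I := VecIndexS d L, c35 := c35, p := p, pi := v1GVecInstance (d := d) 𝔄 ι L hL,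
            Kop := vWGCVecFamily4 (d := d) 𝔄 ι e L a hL (expFc ι e L) (expFsc ι e L) (expFf ι e L) (expFsf ι e L),
            Ksite := Ksite, Kunit := Kunit, inΛ := inΛ, unitDist := unitDist } :=
  ⟨ne2PlusOperator_vectorPiece_vWordsExpC (d := d) e a hd hL c35 hc35, hsite, hunit⟩

end Faces

/-! ## §2 (W2) closers: `S_N15` for every rate-record predicate whose NE2 component IS one of the two constructed-species families plus the two remaining layers -/

section Closers

/-- **`S_N15` FOR EVERY LINEARISED-SPECIES READING**: the operator layer is NOT a hypothesis. [bookkeeping] -/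
theorem s_N15_of_vWordsLinCReading (hd : 1 ≤ d) (hL : 1 ≤ L) (RRec : RateRecordPred N)
    (hread : ∀ (F : T4Family) (D : Datum F N) (g₀ : ℕ → ℝ) (os : List (ULoop F)) (R : RateCarriers N), RRec F D g₀ os R →
      ∃ (c35 a p : ℝ) (Ksite Kunit : ∀ j : VecIndexS d L, SiteKernel (v1GVecInstance (d := d) 𝔄 ι L hL j).gc (v1GVecInstance (d := d) 𝔄 ι L hL j).Bf)
        (inΛ : ∀ j : VecIndexS d L, (v1GVecInstance (d := d) 𝔄 ι L hL j).gc.Site → Prop)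
        (unitDist : ∀ j : VecIndexS d L, (v1GVecInstance (d := d) 𝔄 ι L hL j).gc.Site → (v1GVecInstance (d := d) 𝔄 ι L hL j).gc.Site → ℝ),
        0 < c35 ∧
        R.ne2 = { I := VecIndexS d L, c35 := c35, p := p, pi := v1GVecInstance (d := d) 𝔄 ι L hL,
                  Kop := vWGCVecFamily4 (d := d) 𝔄 ι e L a hL (linFc ι e L) (linFsc ι e L) (linFf ι e L) (linFsf ι e L),
                  Ksite := Ksite, Kunit := Kunit, inΛ := inΛ, unitDist := unitDist } ∧
        NE2PlusSite 4 p c35 (v1GVecInstance (d := d) 𝔄 ι L hL) Ksite ∧ NE2PlusUnit c35 (v1GVecInstance (d := d) 𝔄 ι L hL) Kunit inΛ unitDist) :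
    S_N15 RRec := by
  intro F D g₀ os R hR
  obtain ⟨c35, a, p, Ksite, Kunit, inΛ, unitDist, hc35, hne2, hsite, hunit⟩ := hread F D g₀ os R hR
  rw [hne2]
  exact n15At_vectorPiece_vWordsLinC_of_layers e a hd hL hc35 p Ksite Kunit inΛ unitDist hsite hunit

/-- **`S_N15` FOR EVERY PARALLEL-TRANSPORT-SPECIES READING**: the operator layer is NOT a hypothesis. [bookkeeping] -/
theorem s_N15_of_vWordsExpCReading (hd : 1 ≤ d) (hL : 1 ≤ L) (RRec : RateRecordPred N)
    (hread : ∀ (F : T4Family) (D : Datum F N) (g₀ : ℕ → ℝ) (os : List (ULoop F)) (R : RateCarriers N), RRec F D g₀ os R →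
      ∃ (c35 a p : ℝ) (Ksite Kunit : ∀ j : VecIndexS d L, SiteKernel (v1GVecInstance (d := d) 𝔄 ι L hL j).gc (v1GVecInstance (d := d) 𝔄 ι L hL j).Bf)
        (inΛ : ∀ j : VecIndexS d L, (v1GVecInstance (d := d) 𝔄 ι L hL j).gc.Site → Prop)
        (unitDist : ∀ j : VecIndexS d L, (v1GVecInstance (d := d) 𝔄 ι L hL j).gc.Site → (v1GVecInstance (d := d) 𝔄 ι L hL j).gc.Site → ℝ),
        0 < c35 ∧
        R.ne2 = { I := VecIndexS d L, c35 := c35, p := p, pi := v1GVecInstance (d := d) 𝔄 ι L hL,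
                  Kop := vWGCVecFamily4 (d := d) 𝔄 ι e L a hL (expFc ι e L) (expFsc ι e L) (expFf ι e L) (expFsf ι e L),
                  Ksite := Ksite, Kunit := Kunit, inΛ := inΛ, unitDist := unitDist } ∧
        NE2PlusSite 4 p c35 (v1GVecInstance (d := d) 𝔄 ι L hL) Ksite ∧ NE2PlusUnit c35 (v1GVecInstance (d := d) 𝔄 ι L hL) Kunit inΛ unitDist) :
    S_N15 RRec := by
  intro F D g₀ os R hR
  obtain ⟨c35, a, p, Ksite, Kunit, inΛ, unitDist, hc35, hne2, hsite, hunit⟩ := hread F D g₀ os R hR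
  rw [hne2]
  exact n15At_vectorPiece_vWordsExpC_of_layers e a hd hL hc35 p Ksite Kunit inΛ unitDist hsite hunit

end Closers

/-! ## §3 Guards: on these carriers the operator layer is never the reason `N15At` fails -/

section Guard

/-- **LINEARISED-SPECIES CARRIERS: `N15At` FAILS IFF THE SITE OR THE UNIT LAYER FAILS.** [bookkeeping] -/
theorem not_n15At_iff_site_or_unit_fails_vWordsLinC (hd : 1 ≤ d) (hL : 1 ≤ L) {c35 : ℝ} (hc35 : 0 < c35) (p : ℝ)
    (Ksite Kunit : ∀ j : VecIndexS d L, SiteKernel (v1GVecInstance (d := d) 𝔄 ι L hL j).gc (v1GVecInstance (d := d) 𝔄 ι L hL j).Bf)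
    (inΛ : ∀ j : VecIndexS d L, (v1GVecInstance (d := d) 𝔄 ι L hL j).gc.Site → Prop)
    (unitDist : ∀ j : VecIndexS d L, (v1GVecInstance (d := d) 𝔄 ι L hL j).gc.Site → (v1GVecInstance (d := d) 𝔄 ι L hL j).gc.Site → ℝ) :
    ¬ N15At { I := VecIndexS d L, c35 := c35, p := p, pi := v1GVecInstance (d := d) 𝔄 ι L hL,
              Kop := vWGCVecFamily4 (d := d) 𝔄 ι e L a hL (linFc ι e L) (linFsc ι e L) (linFf ι e L) (linFsf ι e L),
              Ksite := Ksite, Kunit := Kunit, inΛ := inΛ, unitDist := unitDist } ↔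
      ¬ NE2PlusSite 4 p c35 (v1GVecInstance (d := d) 𝔄 ι L hL) Ksite ∨ ¬ NE2PlusUnit c35 (v1GVecInstance (d := d) 𝔄 ι L hL) Kunit inΛ unitDist := by
  constructor
  · intro h
    by_cases hs : NE2PlusSite 4 p c35 (v1GVecInstance (d := d) 𝔄 ι L hL) Ksite
    · by_cases hu : NE2PlusUnit c35 (v1GVecInstance (d := d) 𝔄 ι L hL) Kunit inΛ unitDist
      · exact absurd (n15At_vectorPiece_vWordsLinC_of_layers e a hd hL hc35 p Ksite Kunit inΛ unitDist hs hu) h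
      · exact Or.inr hu
    · exact Or.inl hs
  · rintro (hs | hu) ⟨_, hsite, hunit⟩
    · exact hs hsite
    · exact hu hunit

/-- **PARALLEL-TRANSPORT-SPECIES CARRIERS: `N15At` FAILS IFF THE SITE OR THE UNIT LAYER FAILS.** [bookkeeping] -/
theorem not_n15At_iff_site_or_unit_fails_vWordsExpC (hd : 1 ≤ d) (hL : 1 ≤ L) {c35 : ℝ} (hc35 : 0 < c35) (p : ℝ)
    (Ksite Kunit : ∀ j : VecIndexS d L, SiteKernel (v1GVecInstance (d := d) 𝔄 ι L hL j).gc (v1GVecInstance (d := d) 𝔄 ι L hL j).Bf)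
    (inΛ : ∀ j : VecIndexS d L, (v1GVecInstance (d := d) 𝔄 ι L hL j).gc.Site → Prop)
    (unitDist : ∀ j : VecIndexS d L, (v1GVecInstance (d := d) 𝔄 ι L hL j).gc.Site → (v1GVecInstance (d := d) 𝔄 ι L hL j).gc.Site → ℝ) :
    ¬ N15At { I := VecIndexS d L, c35 := c35, p := p, pi := v1GVecInstance (d := d) 𝔄 ι L hL,
              Kop := vWGCVecFamily4 (d := d) 𝔄 ι e L a hL (expFc ι e L) (expFsc ι e L) (expFf ι e L) (expFsf ι e L),
              Ksite := Ksite, Kunit := Kunit, inΛ := inΛ, unitDist := unitDist } ↔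
      ¬ NE2PlusSite 4 p c35 (v1GVecInstance (d := d) 𝔄 ι L hL) Ksite ∨ ¬ NE2PlusUnit c35 (v1GVecInstance (d := d) 𝔄 ι L hL) Kunit inΛ unitDist := by
  constructor
  · intro h
    by_cases hs : NE2PlusSite 4 p c35 (v1GVecInstance (d := d) 𝔄 ι L hL) Ksite
    · by_cases hu : NE2PlusUnit c35 (v1GVecInstance (d := d) 𝔄 ι L hL) Kunit inΛ unitDist
      · exact absurd (n15At_vectorPiece_vWordsExpC_of_layers e a hd hL hc35 p Ksite Kunit inΛ unitDist hs hu) h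
      · exact Or.inr hu
    · exact Or.inl hs
  · rintro (hs | hu) ⟨_, hsite, hunit⟩
    · exact hs hsite
    · exact hu hunit

end Guard

/-! ## §4 The same three faces for the `V′₁`-only family with the pairing-consistent coarse side (`v1GCVecFamily4`, F13) -/

section FacesV1C

/-- **`N15At` WITH THE PRINT's OWN `V′₁(A)` LIVE, FROM THE SITE AND UNIT LAYERS ALONE.**  On the NE2 carriers indexed by the sized family, with paired instances
`v1GVecInstance` (configurations `(A⁺, A⁻, W)`, (3.35) = the letter pair on each field in the norm of `𝔄`, guard = the index's `M`) and operator kernels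
`v1GCVecFamily4` (V2's constructed pair with `V′₁ = M_c + Σ_μ[M_{a⁺_μ}∇⁺_μ + M_{a⁻_μ}∇⁻_μ]` fed with the -a pieces ⊗ 1_𝔤, forward AND backward derived pieces),
the operator conjunct is `VectorPiece.ne2PlusOperator_vectorPiece_v1` (hypothesis-free for `d + 1 ≥ 2`, `L ≥ 1`, `c₃₅ > 0`); `N15At` follows from the two
displayed layers. [bookkeeping] -/
theorem n15At_vectorPiece_v1GC_of_layers (hd : 1 ≤ d) (hL : 1 ≤ L) {c35 : ℝ} (hc35 : 0 < c35) (p : ℝ)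
    (Ksite Kunit : ∀ j : VecIndexS d L, SiteKernel (v1GVecInstance (d := d) 𝔄 ι L hL j).gc (v1GVecInstance (d := d) 𝔄 ι L hL j).Bf)
    (inΛ : ∀ j : VecIndexS d L, (v1GVecInstance (d := d) 𝔄 ι L hL j).gc.Site → Prop)
    (unitDist : ∀ j : VecIndexS d L, (v1GVecInstance (d := d) 𝔄 ι L hL j).gc.Site → (v1GVecInstance (d := d) 𝔄 ι L hL j).gc.Site → ℝ)
    (hsite : NE2PlusSite 4 p c35 (v1GVecInstance (d := d) 𝔄 ι L hL) Ksite)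
    (hunit : NE2PlusUnit c35 (v1GVecInstance (d := d) 𝔄 ι L hL) Kunit inΛ unitDist) :
    N15At { I := VecIndexS d L, c35 := c35, p := p, pi := v1GVecInstance (d := d) 𝔄 ι L hL, Kop := v1GCVecFamily4 (d := d) 𝔄 ι e L hL,
            Ksite := Ksite, Kunit := Kunit, inΛ := inΛ, unitDist := unitDist } :=
  ⟨ne2PlusOperator_vectorPiece_v1GC (d := d) e hd hL c35 hc35, hsite, hunit⟩

end FacesV1C

/-! ## §2 (W2) closer: `S_N15` for every rate-record predicate whose NE2 component IS the gauge-datum family plus the two remaining layers -/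

section ClosersV1C

/-- **`S_N15` FOR EVERY GAUGE-DATUM READING** (the carriers of `n15At_vectorPiece_v1GC_of_layers`): if `RRec` hands, with every bundle `R` it pins, an identification of
`R.ne2` with those carriers (any `c₃₅ > 0`, exponent `p`, site ∕ unit kernels, region, unit distance) together with the site-kernel and unit-lattice layers on
them, then `S_N15 RRec` — the operator layer is NOT a hypothesis. [bookkeeping] -/
theorem s_N15_of_v1GCReading (hd : 1 ≤ d) (hL : 1 ≤ L) (RRec : RateRecordPred N)
    (hread : ∀ (F : T4Family) (D : Datum F N) (g₀ : ℕ → ℝ) (os : List (ULoop F)) (R : RateCarriers N), RRec F D g₀ os R →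
      ∃ (c35 p : ℝ) (Ksite Kunit : ∀ j : VecIndexS d L, SiteKernel (v1GVecInstance (d := d) 𝔄 ι L hL j).gc (v1GVecInstance (d := d) 𝔄 ι L hL j).Bf)
        (inΛ : ∀ j : VecIndexS d L, (v1GVecInstance (d := d) 𝔄 ι L hL j).gc.Site → Prop)
        (unitDist : ∀ j : VecIndexS d L, (v1GVecInstance (d := d) 𝔄 ι L hL j).gc.Site → (v1GVecInstance (d := d) 𝔄 ι L hL j).gc.Site → ℝ),
        0 < c35 ∧
        R.ne2 = { I := VecIndexS d L, c35 := c35, p := p, pi := v1GVecInstance (d := d) 𝔄 ι L hL, Kop := v1GCVecFamily4 (d := d) 𝔄 ι e L hL,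
                  Ksite := Ksite, Kunit := Kunit, inΛ := inΛ, unitDist := unitDist } ∧
        NE2PlusSite 4 p c35 (v1GVecInstance (d := d) 𝔄 ι L hL) Ksite ∧ NE2PlusUnit c35 (v1GVecInstance (d := d) 𝔄 ι L hL) Kunit inΛ unitDist) :
    S_N15 RRec := by
  intro F D g₀ os R hR
  obtain ⟨c35, p, Ksite, Kunit, inΛ, unitDist, hc35, hne2, hsite, hunit⟩ := hread F D g₀ os R hR
  rw [hne2]
  exact n15At_vectorPiece_v1GC_of_layers e hd hL hc35 p Ksite Kunit inΛ unitDist hsite hunit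

end ClosersV1C

/-! ## §3 Guard: on the gauge-datum carriers the operator layer is never the reason `N15At` fails -/

section GuardV1C

/-- **ON THE GAUGE-DATUM CARRIERS `N15At` FAILS IFF THE SITE OR THE UNIT LAYER FAILS** (the operator layer holds by `VectorPiece.ne2PlusOperator_vectorPiece_v1`): the honest
residue of N15 on this family is the pair of displayed layers. [bookkeeping] -/
theorem not_n15At_iff_site_or_unit_fails_v1GC (hd : 1 ≤ d) (hL : 1 ≤ L) {c35 : ℝ} (hc35 : 0 < c35) (p : ℝ)
    (Ksite Kunit : ∀ j : VecIndexS d L, SiteKernel (v1GVecInstance (d := d) 𝔄 ι L hL j).gc (v1GVecInstance (d := d) 𝔄 ι L hL j).Bf)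
    (inΛ : ∀ j : VecIndexS d L, (v1GVecInstance (d := d) 𝔄 ι L hL j).gc.Site → Prop)
    (unitDist : ∀ j : VecIndexS d L, (v1GVecInstance (d := d) 𝔄 ι L hL j).gc.Site → (v1GVecInstance (d := d) 𝔄 ι L hL j).gc.Site → ℝ) :
    ¬ N15At { I := VecIndexS d L, c35 := c35, p := p, pi := v1GVecInstance (d := d) 𝔄 ι L hL, Kop := v1GCVecFamily4 (d := d) 𝔄 ι e L hL,
              Ksite := Ksite, Kunit := Kunit, inΛ := inΛ, unitDist := unitDist } ↔
      ¬ NE2PlusSite 4 p c35 (v1GVecInstance (d := d) 𝔄 ι L hL) Ksite ∨ ¬ NE2PlusUnit c35 (v1GVecInstance (d := d) 𝔄 ι L hL) Kunit inΛ unitDist := by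
  constructor
  · intro h
    by_cases hs : NE2PlusSite 4 p c35 (v1GVecInstance (d := d) 𝔄 ι L hL) Ksite
    · by_cases hu : NE2PlusUnit c35 (v1GVecInstance (d := d) 𝔄 ι L hL) Kunit inΛ unitDist
      · exact absurd (n15At_vectorPiece_v1GC_of_layers e hd hL hc35 p Ksite Kunit inΛ unitDist hs hu) h
      · exact Or.inr hu
    · exact Or.inl hs
  · rintro (hs | hu) ⟨_, hsite, hunit⟩
    · exact hs hsite
    · exact hu hunit

end GuardV1C

end Summit.QuantumFields.YangMills.Theorems.N15AtSpineCarriers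

end
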